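import Summits.QuantumFields.YangMills.Theorems.BalabanUVNodesK0V23Stub3DoorSuppliersAx
import Summits.QuantumFields.YangMills.Theorems.BalabanUVNodesK2AxHolds

/-!
# NODE N24 (B2) — THE K0ᴬ–K1ᴬ JUNCTION AT THE COFINAL β-SOCKET OF THE RE-CENTRED («Ax») RECORD, BY NAME: the Ax twin of ✓p782828 `…N24K0K1JunctionOfCofinalBetaSocket` — ONE NODE-O deliverable
# (the Ax K1 face ✓`…CofJunctionLSlot8KappaPrimeAtGaussPinPrintedZBYAx`'s ∕ Ax engine ✓p811182's last binder `hβc`, boxes of `betaOfRecord₁₃Ax` at `θᶜᶜᴹᵂᶻᴮᴬˣ`) is k0's Ax door (α_cof) `K0BoxCofinalRadiiAx`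
# PLUS K1ᴬ's rows, hence inhabits K0ᴬ `Record13SepCoPHInhabitedAx` BY NAME (k0's Ax closer ✓`…K0V23Stub3DoorSuppliersAx`); and the rung R4 `BalabanLadder.UV` then needs, beyond the Ax face's children, only K3ᴬ — K2ᴬ being PROVED (`K2AxHolds`)

TRACK A (YM-PLAN §2d, node N24 of 28 = binder B2, COMPOSITE), seat `pub-ymgap-dag-n24-c` (gen 23; helper lane `--supports 27239`, count-neutral).  [I] = [Balaban1987RG1]; [V] = [Balaban1989LargeFieldII];
[B11] = [Balaban1985Variational].

WHY.  Route rev 31+ reads the four cruxes at the RE-CENTRED record (`closes (h0 : Record13SepCoPHInhabitedAx) (h1 : StabilityBRunRowsAtRecordR13SepCoPHVAx) (h2 : EndpointGivenRunRowsR13SepCoPHVAx)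
(h3 : SpineGivenEndpointR13SepCoPHVAx) : BalabanLadder.UV`).  The Ax engine ∕ face display K0ᴬ ⊕ NODE O as ONE binder `hβc : ∀ F, ∀ a > 0, ∃ a₀, 0 < a₀ ≤ a ∧ ∃ (γ₀ ε₂₉ β′) (j ε₀ B₃ B₃′ a₁ Efl logz),
0 < γ₀ ∧ 0 < ε₂₉ ∧ ⟨abs box of `betaOfRecord₁₃Ax` at θ₁₃ᶜᶜᴹᵂᶻᴮᴬˣ(j; ½; a₀; ε₀, ε₂₉; B₃, B₃′, a₀, a₁; Efl, logz) on ]0, γ₀]⟩ ∧ ∃ (b r γ₁ M), 0 < γ₁ ∧ ⟨NODE O's rows (i) (iv) (C) at that β, level γ₁⟩`.  Its box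
part IS the body of k0's Ax door `K0V23Stub3DoorSuppliersAx.K0BoxCofinalRadiiAx` at `F`, conjunct for conjunct; so (§1) `hβc` PROJECTS to (α_cof)ᴬˣ (drop the rows) and (§2) K0ᴬ's route decl
`Record13SepCoPHInhabitedAx` follows BY NAME from the SAME binder by k0's `record13SepCoPHInhabitedAx_of_k0BoxCofinalRadii` — the K0–K1 junction is consistent on the radius axis at the re-centred
record too: ONE producer of `hβc` serves BOTH Ax cruxes (K1ᴬ through the Ax face with its children).  §3 reads the route's `closes` at that junction: with `h0 := §2 hβc` and K2ᴬ PROVED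
(`BalabanUVNodesK2AxHolds.endpointGivenRunRowsR13SepCoPHVAx_holds` ✓p800257), the rung R4 `BalabanLadder.UV` follows from `hβc`, K1ᴬ (= the Ax face's conclusion from `hβc` + its displayed
children) and K3ᴬ `SpineGivenEndpointR13SepCoPHVAx` (stmt-QuantumFields-27247) — by name, nothing else.  Text = ✓p782828's under σ (`betaOfRecord₁₃ ∕ theta13OfThm1CCMWZB ↦ …Ax`, decl names `…Ax`).

WHAT (3 theorems, 0 `def`, 0 `sorry`; standard axioms): §1 `k0BoxCofinalRadiiAx_of_cofinalBetaSocketAx` · §2 ★ `record13SepCoPHInhabitedAx_of_cofinalBetaSocketAx` · §3 ★ `uv_of_cofinalBetaSocketAx_of_k1Ax_of_k3Ax`.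

HONEST FRAMING.  Composition BY NAME (a projection + k0's Ax closer + the route's `closes`); NO estimate; nothing of Bałaban's asserted; `hβc` is NOBODY's theorem (NODE O's wall in the (α_cof)
currency); K0ᴬ ∕ K1ᴬ ∕ K3ᴬ NOT closed (displayed as hypotheses ∕ derived conditionally), K2ᴬ is this seat's g22 theorem; NOT a closure of any item; N24 COMPOSITE — no count moved; one finite 𝕋⁴
programme at fixed ε, Bałaban AS PRINTED; R4 = the conditional finite-𝕋⁴ rung `BalabanLadder.UV` only — NOT continuum ∕ ℝ⁴ ∕ OS ∕ mass gap ∕ Clay: the Yang–Mills mass gap is NOT proved by any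
of this.  No `sorry`, `def`, `instance`, `notation`.
-/


noncomputable section

open scoped BigOperators

namespace Summit.QuantumFields.YangMills.BalabanUVNodes.N24K0K1JunctionOfCofinalBetaSocketAx

open Literature.MathematicalPhysics.QuantumFieldTheory.Balaban1983to89
open Literature.MathematicalPhysics.QuantumFieldTheory.Balaban1983to89.FlowStep
open Literature.MathematicalPhysics.QuantumFieldTheory.Balaban1983to89.Node00
open Literature.MathematicalPhysics.QuantumFieldTheory.Balaban1983to89.T4Continuum (T4Family)
open Summit.QuantumFields.YangMills.Theorems.K0V23Stub3DoorSuppliersAx (K0BoxCofinalRadiiAx record13SepCoPHInhabitedAx_of_k0BoxCofinalRadii)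
open Summit.QuantumFields.YangMills.Theorems.BalabanUVNodesK2AxHolds (endpointGivenRunRowsR13SepCoPHVAx_holds)
open Summit.QuantumFields.YangMills.Theses.BalabanUVNodes (Record13SepCoPHInhabitedAx StabilityBRunRowsAtRecordR13SepCoPHVAx SpineGivenEndpointR13SepCoPHVAx closes)

/-! ## §1. The Ax cofinal β-socket PROJECTS to k0's Ax door (α_cof) (drop NODE O's rows) -/

/-- **THE Ax COFINAL β-SOCKET ⟹ DOOR (α_cof)ᴬˣ**: dropping the rows conjunct of the Ax K1 face's ∕ Ax engine's binder `hβc` gives k0's `K0BoxCofinalRadiiAx` — the box part of the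
socket IS that door's body at `F`, conjunct for conjunct (bookkeeping: one `obtain`). [cite: Balaban1987RG1, Thm 1 p.259, Thm 3 p.264, (1.20)–(1.22) p.264 (bookkeeping)] -/
theorem k0BoxCofinalRadiiAx_of_cofinalBetaSocketAx
    (hβc : ∀ F : T4Family, ∀ a : ℝ, 0 < a → ∃ a₀ : ℝ, 0 < a₀ ∧ a₀ ≤ a ∧
      ∃ (γ₀ ε₂₉ β' : ℝ) (j : ℕ) (ε₀ B₃ B₃' a₁ : ℝ) (Efl logz : B12.RunParams → ℕ → ℝ), 0 < γ₀ ∧ 0 < ε₂₉ ∧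
        BetaLowerH (-β') γ₀ (betaOfRecord₁₃Ax F 2 (theta13OfThm1CCMWZBAx F 2 j (1 / 2) a₀ ε₀ ε₂₉ B₃ B₃' a₀ a₁ Efl logz)) ∧
        BetaUpperH β' γ₀ (betaOfRecord₁₃Ax F 2 (theta13OfThm1CCMWZBAx F 2 j (1 / 2) a₀ ε₀ ε₂₉ B₃ B₃' a₀ a₁ Efl logz)) ∧
        ∃ (b : ℕ → ℝ) (r γ₁ M : ℝ), 0 < γ₁ ∧
          (∀ (n : ℕ) (gs : ℕ → ℝ), RGEqH n (betaOfRecord₁₃Ax F 2 (theta13OfThm1CCMWZBAx F 2 j (1 / 2) a₀ ε₀ ε₂₉ B₃ B₃' a₀ a₁ Efl logz)) gs → Step.InInterval γ₁ n gs → ∀ k, k ≤ n → |betaOfRecord₁₃Ax F 2 (theta13OfThm1CCMWZBAx F 2 j (1 / 2) a₀ ε₀ ε₂₉ B₃ B₃' a₀ a₁ Efl logz) k (prefixOf gs k) - b k| ≤ r) ∧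
          (∀ (n : ℕ) (gs : ℕ → ℝ), RGEqH n (betaOfRecord₁₃Ax F 2 (theta13OfThm1CCMWZBAx F 2 j (1 / 2) a₀ ε₀ ε₂₉ B₃ B₃' a₀ a₁ Efl logz)) gs → Step.InInterval γ₁ n gs → ∀ k, k ≤ n → -M ≤ ∑ i ∈ Finset.Ico k n, betaOfRecord₁₃Ax F 2 (theta13OfThm1CCMWZBAx F 2 j (1 / 2) a₀ ε₀ ε₂₉ B₃ B₃' a₀ a₁ Efl logz) i (prefixOf gs i)) ∧
          ∀ k : ℕ, ContinuousOn (fun x : ℝ => betaOfRecord₁₃Ax F 2 (theta13OfThm1CCMWZBAx F 2 j (1 / 2) a₀ ε₀ ε₂₉ B₃ B₃' a₀ a₁ Efl logz) k (clampPrefix (betaOfRecord₁₃Ax F 2 (theta13OfThm1CCMWZBAx F 2 j (1 / 2) a₀ ε₀ ε₂₉ B₃ B₃' a₀ a₁ Efl logz)) γ₁ k x))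
            {x : ℝ | 0 < x ∧ x ≤ γ₁ ∧ ∀ i, i ≤ k → 1 / γ₁ ^ 2 ≤ Y (betaOfRecord₁₃Ax F 2 (theta13OfThm1CCMWZBAx F 2 j (1 / 2) a₀ ε₀ ε₂₉ B₃ B₃' a₀ a₁ Efl logz)) γ₁ i x}) :
    K0BoxCofinalRadiiAx := by
  intro F a ha
  obtain ⟨a₀, ha₀, hle, γ₀, ε₂₉, β', j, ε₀, B₃, B₃', a₁, Efl, logz, hγ₀, hε, hlow, hup, -⟩ := hβc F a ha
  exact ⟨a₀, ha₀, hle, γ₀, ε₂₉, β', j, ε₀, B₃, B₃', a₁, Efl, logz, hγ₀, hε, hlow, hup⟩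

/-! ## §2. ★ K0ᴬ's route decl BY NAME from the Ax cofinal β-socket (k0's Ax closer `record13SepCoPHInhabitedAx_of_k0BoxCofinalRadii`) -/

/-- **★ THE K0ᴬ–K1ᴬ JUNCTION ON THE RADIUS AXIS**: the Ax cofinal β-socket `hβc` inhabits K0ᴬ `Theses.BalabanUVNodes.Record13SepCoPHInhabitedAx` BY NAME (§1 ∘ k0's
`K0V23Stub3DoorSuppliersAx.record13SepCoPHInhabitedAx_of_k0BoxCofinalRadii`: stub 1ᴮ's token shrunk to the producer's radius, 2′ printed, the ᴮ seam `rfl`, re-centred Z witness).  So ONE NODE-O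
producer of `hβc` serves K0ᴬ directly AND K1ᴬ through the Ax face (with its displayed children).  CONDITIONAL on `hβc` (nobody's theorem); K0ᴬ NOT closed. [cite: Balaban1985Variational, Thm 1 (8)–(9) p.279, Prop. 8 p.304; Balaban1985RegularSpaces, Prop. 6 p.99; Balaban1988Convergent, Thm 1 p.262, (2.12)–(2.13) pp.256–257; Balaban1987RG1, Thm 1 p.259, Thm 3 p.264, (1.20)–(1.22) p.264 (bookkeeping)] -/
theorem record13SepCoPHInhabitedAx_of_cofinalBetaSocketAx
    (hβc : ∀ F : T4Family, ∀ a : ℝ, 0 < a → ∃ a₀ : ℝ, 0 < a₀ ∧ a₀ ≤ a ∧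
      ∃ (γ₀ ε₂₉ β' : ℝ) (j : ℕ) (ε₀ B₃ B₃' a₁ : ℝ) (Efl logz : B12.RunParams → ℕ → ℝ), 0 < γ₀ ∧ 0 < ε₂₉ ∧
        BetaLowerH (-β') γ₀ (betaOfRecord₁₃Ax F 2 (theta13OfThm1CCMWZBAx F 2 j (1 / 2) a₀ ε₀ ε₂₉ B₃ B₃' a₀ a₁ Efl logz)) ∧
        BetaUpperH β' γ₀ (betaOfRecord₁₃Ax F 2 (theta13OfThm1CCMWZBAx F 2 j (1 / 2) a₀ ε₀ ε₂₉ B₃ B₃' a₀ a₁ Efl logz)) ∧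
        ∃ (b : ℕ → ℝ) (r γ₁ M : ℝ), 0 < γ₁ ∧
          (∀ (n : ℕ) (gs : ℕ → ℝ), RGEqH n (betaOfRecord₁₃Ax F 2 (theta13OfThm1CCMWZBAx F 2 j (1 / 2) a₀ ε₀ ε₂₉ B₃ B₃' a₀ a₁ Efl logz)) gs → Step.InInterval γ₁ n gs → ∀ k, k ≤ n → |betaOfRecord₁₃Ax F 2 (theta13OfThm1CCMWZBAx F 2 j (1 / 2) a₀ ε₀ ε₂₉ B₃ B₃' a₀ a₁ Efl logz) k (prefixOf gs k) - b k| ≤ r) ∧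
          (∀ (n : ℕ) (gs : ℕ → ℝ), RGEqH n (betaOfRecord₁₃Ax F 2 (theta13OfThm1CCMWZBAx F 2 j (1 / 2) a₀ ε₀ ε₂₉ B₃ B₃' a₀ a₁ Efl logz)) gs → Step.InInterval γ₁ n gs → ∀ k, k ≤ n → -M ≤ ∑ i ∈ Finset.Ico k n, betaOfRecord₁₃Ax F 2 (theta13OfThm1CCMWZBAx F 2 j (1 / 2) a₀ ε₀ ε₂₉ B₃ B₃' a₀ a₁ Efl logz) i (prefixOf gs i)) ∧
          ∀ k : ℕ, ContinuousOn (fun x : ℝ => betaOfRecord₁₃Ax F 2 (theta13OfThm1CCMWZBAx F 2 j (1 / 2) a₀ ε₀ ε₂₉ B₃ B₃' a₀ a₁ Efl logz) k (clampPrefix (betaOfRecord₁₃Ax F 2 (theta13OfThm1CCMWZBAx F 2 j (1 / 2) a₀ ε₀ ε₂₉ B₃ B₃' a₀ a₁ Efl logz)) γ₁ k x))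
            {x : ℝ | 0 < x ∧ x ≤ γ₁ ∧ ∀ i, i ≤ k → 1 / γ₁ ^ 2 ≤ Y (betaOfRecord₁₃Ax F 2 (theta13OfThm1CCMWZBAx F 2 j (1 / 2) a₀ ε₀ ε₂₉ B₃ B₃' a₀ a₁ Efl logz)) γ₁ i x}) :
    Record13SepCoPHInhabitedAx :=
  record13SepCoPHInhabitedAx_of_k0BoxCofinalRadii (k0BoxCofinalRadiiAx_of_cofinalBetaSocketAx hβc)

/-! ## §3. ★ The rung R4 read at this junction: `BalabanLadder.UV` from `hβc`, K1ᴬ and K3ᴬ BY NAME (K2ᴬ PROVED) -/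

/-- **★ THE RUNG AT THE Ax JUNCTION**: the route's deciding theorem `Theses.BalabanUVNodes.closes` (rev 31+: hypotheses K0ᴬ ∕ K1ᴬ ∕ K2ᴬ ∕ K3ᴬ) with `h0 :=` §2 (K0ᴬ from the Ax cofinal β-socket)
and `h2 :=` the PROVED K2ᴬ (`BalabanUVNodesK2AxHolds.endpointGivenRunRowsR13SepCoPHVAx_holds`): the rung R4 `Theses.BalabanLadder.UV` follows from `hβc`, K1ᴬ `StabilityBRunRowsAtRecordR13SepCoPHVAx`
(itself = the Ax K1 face's conclusion from `hβc` and its displayed N05–N13 children) and K3ᴬ `SpineGivenEndpointR13SepCoPHVAx` (stmt-QuantumFields-27247) — by name, nothing else.  CONDITIONAL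
(audit `proof.conditional`); R4 NOT proved; no count moved. [cite: Balaban1989LargeFieldII, Thm 1 p.355; Balaban1987RG1, Thm 3 p.264 (bookkeeping)] -/
theorem uv_of_cofinalBetaSocketAx_of_k1Ax_of_k3Ax
    (hβc : ∀ F : T4Family, ∀ a : ℝ, 0 < a → ∃ a₀ : ℝ, 0 < a₀ ∧ a₀ ≤ a ∧
      ∃ (γ₀ ε₂₉ β' : ℝ) (j : ℕ) (ε₀ B₃ B₃' a₁ : ℝ) (Efl logz : B12.RunParams → ℕ → ℝ), 0 < γ₀ ∧ 0 < ε₂₉ ∧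
        BetaLowerH (-β') γ₀ (betaOfRecord₁₃Ax F 2 (theta13OfThm1CCMWZBAx F 2 j (1 / 2) a₀ ε₀ ε₂₉ B₃ B₃' a₀ a₁ Efl logz)) ∧
        BetaUpperH β' γ₀ (betaOfRecord₁₃Ax F 2 (theta13OfThm1CCMWZBAx F 2 j (1 / 2) a₀ ε₀ ε₂₉ B₃ B₃' a₀ a₁ Efl logz)) ∧
        ∃ (b : ℕ → ℝ) (r γ₁ M : ℝ), 0 < γ₁ ∧
          (∀ (n : ℕ) (gs : ℕ → ℝ), RGEqH n (betaOfRecord₁₃Ax F 2 (theta13OfThm1CCMWZBAx F 2 j (1 / 2) a₀ ε₀ ε₂₉ B₃ B₃' a₀ a₁ Efl logz)) gs → Step.InInterval γ₁ n gs → ∀ k, k ≤ n → |betaOfRecord₁₃Ax F 2 (theta13OfThm1CCMWZBAx F 2 j (1 / 2) a₀ ε₀ ε₂₉ B₃ B₃' a₀ a₁ Efl logz) k (prefixOf gs k) - b k| ≤ r) ∧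
          (∀ (n : ℕ) (gs : ℕ → ℝ), RGEqH n (betaOfRecord₁₃Ax F 2 (theta13OfThm1CCMWZBAx F 2 j (1 / 2) a₀ ε₀ ε₂₉ B₃ B₃' a₀ a₁ Efl logz)) gs → Step.InInterval γ₁ n gs → ∀ k, k ≤ n → -M ≤ ∑ i ∈ Finset.Ico k n, betaOfRecord₁₃Ax F 2 (theta13OfThm1CCMWZBAx F 2 j (1 / 2) a₀ ε₀ ε₂₉ B₃ B₃' a₀ a₁ Efl logz) i (prefixOf gs i)) ∧
          ∀ k : ℕ, ContinuousOn (fun x : ℝ => betaOfRecord₁₃Ax F 2 (theta13OfThm1CCMWZBAx F 2 j (1 / 2) a₀ ε₀ ε₂₉ B₃ B₃' a₀ a₁ Efl logz) k (clampPrefix (betaOfRecord₁₃Ax F 2 (theta13OfThm1CCMWZBAx F 2 j (1 / 2) a₀ ε₀ ε₂₉ B₃ B₃' a₀ a₁ Efl logz)) γ₁ k x))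
            {x : ℝ | 0 < x ∧ x ≤ γ₁ ∧ ∀ i, i ≤ k → 1 / γ₁ ^ 2 ≤ Y (betaOfRecord₁₃Ax F 2 (theta13OfThm1CCMWZBAx F 2 j (1 / 2) a₀ ε₀ ε₂₉ B₃ B₃' a₀ a₁ Efl logz)) γ₁ i x})
    (hK1 : StabilityBRunRowsAtRecordR13SepCoPHVAx) (hK3 : SpineGivenEndpointR13SepCoPHVAx) :
    Summit.QuantumFields.YangMills.Theses.BalabanLadder.UV :=
  closes (record13SepCoPHInhabitedAx_of_cofinalBetaSocketAx hβc) hK1 endpointGivenRunRowsR13SepCoPHVAx_holds hK3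

end Summit.QuantumFields.YangMills.BalabanUVNodes.N24K0K1JunctionOfCofinalBetaSocketAx

end
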